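import Summits.QuantumFields.BalabanUV.T4Continuum.Support.ShellMeasureLinearizedFromQ

/-!
# `T4Continuum.ShellMeasureEquivariantGerm` — (LR)_j, W-d analytic half: (Q4) IS A GERM CONDITION.  The
# ⋆-equivariance `Q̃ ∘ κ_𝒴 = κ_𝒳 ∘ Q̃` of an ANALYTIC average-in-the-chart holds on its WHOLE analyticity ball as soon
# as it holds NEAR `0` (identity principle over `ℝ`); S46's ENDs with the germ hypothesis; the germ from a
# regime-conditional identity (row S47's shape) by CONTINUITY at `0`
(cell `pub-balaban`, sub-cell `t4`, spine estimate NE7c (node U5b); NE7c ROUND-2 crew `t4-ne7c-formalise-*`, seat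
`b2b-balaban-t4-ne7c-formalise-leaf-10` gen 8; ROW S51 of the owner table `t4/b2b-balaban-t4-ne7c-p1/LEAVES-NE7c-P1.md`
v2.2 — the owner's RULING R-ne7cp1-g28-2 «the (Q4) route OF RECORD» (journal `CLAIMS.log` OFFER «(Q4) IS A GERM
CONDITION», BOOKED S51); rows S46–S53 = WALL §3 W-d's analytic half; ADDITIVE — imports leaf-08-g10's row-S46 file
`ShellMeasureLinearizedFromQ` (p218633) ONLY and modifies nothing; [folklore] complex analysis; 0 `def`,
0 `def … : Prop`, 0 sorry, 0 citation — nothing printed is asserted)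

HONEST FRAMING.  Finite four-torus programme, rung (B)+1 only — NOT infinite volume, NOT a mass gap, NOT the Clay
problem, NOT summit progress; (B), `BetaPertHyp`, (B^μ) not consumed.  NE7c (`T4IndicatorShell.ShellWeightBound`) is
NOT PRINTED and NOT PROVED; «NE7c ⇐ the named binders» (trigger c3).  This file discharges NO binder of the wall; it
is an INTERFACE LEMMA for the assembly «(LR)_j chart data for the PRINTED average = S46 ∘ (S47 (Q4), S48∕S50 `hop`,
S49 (Q1)–(Q3))».  NOTHING in the countdown moves; spine PROVED 0/9.  HONEST DEPENDENCY (cell, verbatim): continuum YM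
on T⁴ ⇐ BetaPertH ∧ nine spine estimates (0/9 proved); BetaPertH ⇐ (D1) ∧ (D4) ∧ CAP+tail; G-an2-4 gates asym, D1
and NE2/3/4.

THE POINT.  Row S46 (`ShellMeasureLinearizedFromQ.realForm_chartData_of_Q`) derives every analytic binder of the
curved-fibre-chart ENDs' real chart data from four hypotheses on ONE map `Qt : 𝒴 → 𝒳` and a right inverse `hop`;
its reality hypothesis is (Q4) `∀ B ∈ ball 0 R, Qt (κ_𝒴 B) = κ_𝒳 (Qt B)` on the WHOLE analyticity ball.  For the
printed block average ([Balaban1987RG1] (2.4) ∕ [Balaban1985Averaging] (15), `B12AverageCorridor267.Qtilde`) row S47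
(`ShellMeasureAverageReal.star_Qtilde`) proves the ⋆-identity only in the `mlog` regime — block loops of `V′V` and of
`V` and the quotient `M_c(V′V)M_c(V)⁻¹` within `1∕3` of `1` —, so the assembly would need quantitative regime radii
on which those three smallness conditions persist (the «mlog-regime smallness» listed by the crew referee, pass 12,
among the W-d residuals).  THIS FILE removes that bookkeeping:
* §1 **`conj_eqOn_ball_of_eventually`** — for `Qt` analytic on `ball 0 R` (Q1) and conjugations `κ_𝒴`, `κ_𝒳`
  (conjugate-linear isometric equivalences, S40's type `≃ₗᵢ⋆[ℂ]`): if `Qt (κ_𝒴 B) = κ_𝒳 (Qt B)` for all `B` NEAR `0`,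
  then it holds for ALL `B ∈ ball 0 R`.  Proof: both composites `Qt ∘ κ_𝒴` and `κ_𝒳 ∘ Qt` are REAL-analytic on the
  ball (`AnalyticOnNhd.restrictScalars`, the conjugations as the real continuous linear maps
  `ShellMeasureLinearizedRealStructure.conjR`), the ball is preconnected, and Mathlib's identity principle
  `AnalyticOnNhd.eqOn_of_preconnected_of_eventuallyEq` applies over `ℝ` (no completeness, no finite dimension; for
  `R ≤ 0` the statement is vacuous).
* §2 S46's ENDs RE-EXPORTED with (Q4) replaced by its GERM `hQt0 : ∀ᶠ B in 𝓝 0, Qt (κ_𝒴 B) = κ_𝒳 (Qt B)`: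
  `nonlin_conj_of_eventually`, `fderiv_zero_real_of_eventually`, **`realForm_chartData_of_Q_germ`**,
  **`exists_realForm_chartData_of_Q_germ`**, **`realForm_chartData_of_Q'_germ`** — conclusions LITERALLY S46's.
* §3 THE GERM BY CONTINUITY, in row S47's currency: `eventually_norm_sub_one_le` (a map continuous at `0` whose
  value at `0` is within `< r` of `1` stays within `≤ r` near `0`), `eventually_regime` (finitely many such maps
  `W x`, `x ∈ s`, and one map `Z` — S47's three `≤ 1∕3` hypotheses hold EVENTUALLY at `0` once they hold STRICTLY at
  `0`), and **`conj_eqOn_ball_of_regime`**: an S47-SHAPED regime-conditional identity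
  `(∀ x ∈ s, ‖W x B − 1‖ ≤ r) → ‖Z B − 1‖ ≤ r → Qt (κ_𝒴 B) = κ_𝒳 (Qt B)` plus continuity at `0` of the `W x` and of
  `Z` with `‖W x 0 − 1‖ < r`, `‖Z 0 − 1‖ < r` gives (Q4) on ALL of `ball 0 R`.  At the printed average the data are:
  `W x B = W_x(V′V)` (at `B′ = 0` this is `W_x(V)`, within `ε ≤ 1∕8 < 1∕3` of `1` by the background's own loop
  regularity, `B12AverageCorridor267.pert_zero`), `Z(0) = 1`, continuity ⇐ the words' analyticity (row S49), and the
  regime-conditional identity = `star_Qtilde` read with `κ := starₗᵢ ℂ` componentwise (S47 §5 `restrict_star`) —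
  an instance this file does NOT write (row S49 file 2's names are not in the tree yet).
WHICH END ∕ BINDER: feeds S46 §4 (hence `ShellMeasureLinearizedRealStructure` §2 → `…RealForm` §4 → `…Constraint`
§2 → `…Chart` §3–§4, the (LR)_j reading of record, RULING T-NE7c-8); it WEAKENS S46's displayed (Q4) from the ball
to the germ at `0`; it mints nothing (trigger c2) and asserts nothing of [Balaban 1983–89].  What remains of W-d is
unchanged in kind: S49 file 2 ((Q1)–(Q3) for the printed average), S48∕S50 (`hop`), node O [dict].
-/

noncomputable section

open Set Metric Filter Topology

namespace Summit.QuantumFields.BalabanUV.T4Continuum.ShellMeasureEquivariantGerm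

open Literature.MathematicalPhysics.QuantumFieldTheory.Balaban1983to89
open Summit.QuantumFields.BalabanUV.Beta.LinearizingChange267FromQ (nonlin Mq)
open ShellMeasureLinearizedRealStructure (conjR conjR_apply realSub incl reP)
open ShellMeasureLinearizedFromQ (realForm_chartData_of_Q exists_realForm_chartData_of_Q realForm_chartData_of_Q'
  fderiv_zero_conj_of_eventually_equivariant)

variable {𝒳 𝒴 : Type*} [NormedAddCommGroup 𝒳] [NormedSpace ℂ 𝒳] [NormedAddCommGroup 𝒴] [NormedSpace ℂ 𝒴]
  {Qt : 𝒴 → 𝒳} {R MQ b ε : ℝ} {hop : 𝒳 →ₗ[ℂ] 𝒴} {κX : 𝒳 ≃ₗᵢ⋆[ℂ] 𝒳} {κY : 𝒴 ≃ₗᵢ⋆[ℂ] 𝒴}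

/-! ## §1 The identity principle over `ℝ` for the two composites `Q̃ ∘ κ_𝒴` and `κ_𝒳 ∘ Q̃` -/

/-- a conjugation maps the analyticity ball onto itself (isometry). [folklore] -/
theorem conj_mem_ball (κ : 𝒴 ≃ₗᵢ⋆[ℂ] 𝒴) {B : 𝒴} (hB : B ∈ ball (0 : 𝒴) R) : κ B ∈ ball (0 : 𝒴) R := by
  rw [mem_ball_zero_iff] at hB ⊢
  rwa [LinearIsometryEquiv.norm_map]

/-- `Q̃ ∘ κ_𝒴` is REAL-analytic on the ball: a complex-analytic map after a real continuous linear map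
(`ShellMeasureLinearizedRealStructure.conjR`). [folklore] -/
theorem analyticOnNhd_comp_conj (hQa : AnalyticOnNhd ℂ Qt (ball 0 R)) :
    AnalyticOnNhd ℝ (fun B => Qt (κY B)) (ball (0 : 𝒴) R) := by
  intro B hB
  have h1 : AnalyticAt ℝ Qt (conjR κY B) := (hQa _ (conj_mem_ball κY hB)).restrictScalars
  have h2 : AnalyticAt ℝ (conjR κY) B := (conjR κY).analyticAt B
  exact h1.comp h2

/-- `κ_𝒳 ∘ Q̃` is REAL-analytic on the ball. [folklore] -/
theorem analyticOnNhd_conj_comp (hQa : AnalyticOnNhd ℂ Qt (ball 0 R)) :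
    AnalyticOnNhd ℝ (fun B => κX (Qt B)) (ball (0 : 𝒴) R) := by
  intro B hB
  have h1 : AnalyticAt ℝ (conjR κX) (Qt B) := (conjR κX).analyticAt (Qt B)
  have h2 : AnalyticAt ℝ Qt B := (hQa B hB).restrictScalars
  exact h1.comp h2

/-- **(Q4) IS A GERM CONDITION.**  For `Qt` complex-analytic on `ball 0 R` and conjugations `κ_𝒴`, `κ_𝒳`: if
`Qt (κ_𝒴 B) = κ_𝒳 (Qt B)` for all `B` in SOME neighbourhood of `0`, then it holds for EVERY `B ∈ ball 0 R` — the
identity principle (`AnalyticOnNhd.eqOn_of_preconnected_of_eventuallyEq`) for the two REAL-analytic composites on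
the preconnected ball; vacuous for `R ≤ 0`. [folklore] -/
theorem conj_eqOn_ball_of_eventually (hQa : AnalyticOnNhd ℂ Qt (ball 0 R))
    (hQt0 : ∀ᶠ B in 𝓝 (0 : 𝒴), Qt (κY B) = κX (Qt B)) :
    ∀ B ∈ ball (0 : 𝒴) R, Qt (κY B) = κX (Qt B) := by
  intro B hB
  rcases le_or_gt R 0 with hR | hR
  · exact absurd hB (by rw [Metric.ball_eq_empty.2 hR]; exact notMem_empty B)
  · exact (analyticOnNhd_comp_conj hQa).eqOn_of_preconnected_of_eventuallyEq (analyticOnNhd_conj_comp hQa)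
      (convex_ball (0 : 𝒴) R).isPreconnected (mem_ball_self hR) hQt0 hB

/-- conversely (trivial direction, recorded for symmetry): (Q4) on a ball of positive radius is in particular a
germ condition at `0`. [folklore] -/
theorem eventually_conj_of_ball (hR : 0 < R) (hQt : ∀ B ∈ ball (0 : 𝒴) R, Qt (κY B) = κX (Qt B)) :
    ∀ᶠ B in 𝓝 (0 : 𝒴), Qt (κY B) = κX (Qt B) := by
  filter_upwards [ball_mem_nhds (0 : 𝒴) hR] with B hB using hQt B hB

/-! ## §2 Row S46's consequences and ENDs with the germ hypothesis -/

/-- reality of `C̃ := Q̃ − LQ̃` from the GERM of (Q4) (S46 `nonlin_conj_of_equivariant` ∘ §1). [folklore] -/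
theorem nonlin_conj_of_eventually (hR : 0 < R) (hQa : AnalyticOnNhd ℂ Qt (ball 0 R))
    (hQt0 : ∀ᶠ B in 𝓝 (0 : 𝒴), Qt (κY B) = κX (Qt B)) :
    ∀ Y : 𝒴, ‖Y‖ < R → nonlin Qt (κY Y) = κX (nonlin Qt Y) :=
  ShellMeasureLinearizedFromQ.nonlin_conj_of_equivariant hR hQa (conj_eqOn_ball_of_eventually hQa hQt0)

/-- the real part of `LQ̃ := DQ̃(0)` from the GERM of (Q4): `κ_𝒳 (LQ̃ B) = LQ̃ B` for real `B` — S46's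
`fderiv_zero_conj_of_eventually_equivariant` needs only differentiability at `0`, supplied by (Q1). [folklore] -/
theorem fderiv_zero_real_of_eventually (hR : 0 < R) (hQa : AnalyticOnNhd ℂ Qt (ball 0 R))
    (hQt0 : ∀ᶠ B in 𝓝 (0 : 𝒴), Qt (κY B) = κX (Qt B)) {B : 𝒴} (hB : κY B = B) :
    κX (fderiv ℂ Qt 0 B) = fderiv ℂ Qt 0 B := by
  rw [← fderiv_zero_conj_of_eventually_equivariant (hQa 0 (mem_ball_self hR)).differentiableAt hQt0 B, hB]

section Junction

variable [CompleteSpace 𝒳] [CompleteSpace 𝒴]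

/-- **S46's END WITH THE GERM OF (Q4)** — `ShellMeasureLinearizedFromQ.realForm_chartData_of_Q` WORD FOR WORD except
that the ball hypothesis `hQt : ∀ B ∈ ball 0 R, Qt (κ_𝒴 B) = κ_𝒳 (Qt B)` is REPLACED by
`hQt0 : ∀ᶠ B in 𝓝 0, Qt (κ_𝒴 B) = κ_𝒳 (Qt B)`; the conclusion (the four-clause real chart data on `Fix κ_𝒴`) is
S46's token for token. [folklore] -/
theorem realForm_chartData_of_Q_germ [MeasurableSpace 𝒴] [BorelSpace 𝒴] [FiniteDimensional ℂ 𝒴]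
    [MeasurableSpace 𝒳] [BorelSpace 𝒳] (hκX : ∀ X, κX (κX X) = X) (hκY : ∀ B, κY (κY B) = B)
    (hR : 0 < R) (hQa : AnalyticOnNhd ℂ Qt (ball 0 R)) (hQ0 : Qt 0 = 0)
    (hQM : ∀ B ∈ ball (0 : 𝒴) R, ‖Qt B‖ ≤ MQ) (hQt0 : ∀ᶠ B in 𝓝 (0 : 𝒴), Qt (κY B) = κX (Qt B))
    (hLQh : ∀ X, fderiv ℂ Qt 0 (hop X) = X) (hb : 0 ≤ b) (hHop : ∀ X, ‖hop X‖ ≤ b * ‖X‖)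
    (hhop : ∀ X, hop (κX X) = κY (hop X)) (hq : 9 * Mq R MQ * b * ε < 1) (hRC : 3 * ε ≤ R)
    {Dt : 𝒴 → 𝒳} (hDball : ∀ B : 𝒴, ‖B‖ < ε → Dt B ∈ closedBall (0 : 𝒳) (4 * Mq R MQ * ε ^ 2))
    (hDfix : ∀ B : 𝒴, ‖B‖ < ε → nonlin Qt (B - hop (Dt B)) = Dt B)
    {Kf : Type*} [NormedAddCommGroup Kf] [NormedSpace ℝ Kf] (Ψ : (Kf × realSub κX) ≃L[ℝ] realSub κY)
    (hΨ : ∀ y, (Ψ.symm y).2 = (reP κX hκX ∘L (fderiv ℂ Qt 0).restrictScalars ℝ ∘L incl κY) y) :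
    Measurable (fun B : realSub κY => B - (reP κY hκY ∘L (hop.mkContinuous b hHop).restrictScalars ℝ ∘L
        incl κX) (({y : realSub κY | ‖incl κY y‖ < ε}).piecewise
          (fun y => reP κX hκX (Dt (incl κY y))) 0 B)) ∧
      InjOn (fun B : realSub κY => B - (reP κY hκY ∘L (hop.mkContinuous b hHop).restrictScalars ℝ ∘L
        incl κX) (({y : realSub κY | ‖incl κY y‖ < ε}).piecewise
          (fun y => reP κX hκX (Dt (incl κY y))) 0 B))
        {y : realSub κY | ‖incl κY y‖ < ε} ∧
      (∀ B ∈ {y : realSub κY | ‖incl κY y‖ < ε}, HasFDerivWithinAt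
        (fun B : realSub κY => B - (reP κY hκY ∘L (hop.mkContinuous b hHop).restrictScalars ℝ ∘L
          incl κX) (({y : realSub κY | ‖incl κY y‖ < ε}).piecewise
            (fun y => reP κX hκX (Dt (incl κY y))) 0 B))
        (ContinuousLinearMap.id ℝ (realSub κY) - (reP κY hκY ∘L (hop.mkContinuous b hHop).restrictScalars ℝ ∘L
          incl κX).comp (reP κX hκX ∘L (fderiv ℂ Dt (incl κY B)).restrictScalars ℝ ∘L
            incl κY)) {y : realSub κY | ‖incl κY y‖ < ε} B) ∧
      ∀ B ∈ {y : realSub κY | ‖incl κY y‖ < ε},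
        (reP κX hκX ∘L (fderiv ℂ Qt 0).restrictScalars ℝ ∘L incl κY) (B - (reP κY hκY ∘L
            (hop.mkContinuous b hHop).restrictScalars ℝ ∘L incl κX)
            (({y : realSub κY | ‖incl κY y‖ < ε}).piecewise
              (fun y => reP κX hκX (Dt (incl κY y))) 0 B)) +
          (fun y => reP κX hκX (nonlin Qt (incl κY y))) (B - (reP κY hκY ∘L
            (hop.mkContinuous b hHop).restrictScalars ℝ ∘L incl κX)
            (({y : realSub κY | ‖incl κY y‖ < ε}).piecewise
              (fun y => reP κX hκX (Dt (incl κY y))) 0 B)) = (Ψ.symm B).2 :=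
  realForm_chartData_of_Q hκX hκY hR hQa hQ0 hQM (conj_eqOn_ball_of_eventually hQa hQt0) hLQh hb hHop hhop hq hRC
    hDball hDfix Ψ hΨ

/-- **S46's END WITH `D̃` SUPPLIED, GERM FORM** — `ShellMeasureLinearizedFromQ.exists_realForm_chartData_of_Q` with
`hQt` replaced by the germ `hQt0`. [folklore] -/
theorem exists_realForm_chartData_of_Q_germ [MeasurableSpace 𝒴] [BorelSpace 𝒴] [FiniteDimensional ℂ 𝒴]
    [MeasurableSpace 𝒳] [BorelSpace 𝒳] (hκX : ∀ X, κX (κX X) = X) (hκY : ∀ B, κY (κY B) = B)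
    (hR : 0 < R) (hQa : AnalyticOnNhd ℂ Qt (ball 0 R)) (hQ0 : Qt 0 = 0)
    (hQM : ∀ B ∈ ball (0 : 𝒴) R, ‖Qt B‖ ≤ MQ) (hQt0 : ∀ᶠ B in 𝓝 (0 : 𝒴), Qt (κY B) = κX (Qt B))
    (hLQh : ∀ X, fderiv ℂ Qt 0 (hop X) = X) (hb : 0 ≤ b) (hHop : ∀ X, ‖hop X‖ ≤ b * ‖X‖)
    (hhop : ∀ X, hop (κX X) = κY (hop X)) (hq : 9 * Mq R MQ * b * ε < 1) (hRC : 3 * ε ≤ R)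
    {Kf : Type*} [NormedAddCommGroup Kf] [NormedSpace ℝ Kf] (Ψ : (Kf × realSub κX) ≃L[ℝ] realSub κY)
    (hΨ : ∀ y, (Ψ.symm y).2 = (reP κX hκX ∘L (fderiv ℂ Qt 0).restrictScalars ℝ ∘L incl κY) y) :
    ∃ Dt : 𝒴 → 𝒳,
      (∀ B : 𝒴, ‖B‖ < ε → Dt B ∈ closedBall (0 : 𝒳) (4 * Mq R MQ * ε ^ 2) ∧
        nonlin Qt (B - hop (Dt B)) = Dt B ∧ Qt (B - hop (Dt B)) = fderiv ℂ Qt 0 B) ∧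
      Measurable (fun B : realSub κY => B - (reP κY hκY ∘L (hop.mkContinuous b hHop).restrictScalars ℝ ∘L
          incl κX) (({y : realSub κY | ‖incl κY y‖ < ε}).piecewise
            (fun y => reP κX hκX (Dt (incl κY y))) 0 B)) ∧
      InjOn (fun B : realSub κY => B - (reP κY hκY ∘L (hop.mkContinuous b hHop).restrictScalars ℝ ∘L
          incl κX) (({y : realSub κY | ‖incl κY y‖ < ε}).piecewise
            (fun y => reP κX hκX (Dt (incl κY y))) 0 B))
          {y : realSub κY | ‖incl κY y‖ < ε} ∧
      (∀ B ∈ {y : realSub κY | ‖incl κY y‖ < ε}, HasFDerivWithinAt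
          (fun B : realSub κY => B - (reP κY hκY ∘L (hop.mkContinuous b hHop).restrictScalars ℝ ∘L
            incl κX) (({y : realSub κY | ‖incl κY y‖ < ε}).piecewise
              (fun y => reP κX hκX (Dt (incl κY y))) 0 B))
          (ContinuousLinearMap.id ℝ (realSub κY) - (reP κY hκY ∘L (hop.mkContinuous b hHop).restrictScalars ℝ ∘L
            incl κX).comp (reP κX hκX ∘L (fderiv ℂ Dt (incl κY B)).restrictScalars ℝ ∘L
              incl κY)) {y : realSub κY | ‖incl κY y‖ < ε} B) ∧
      ∀ B ∈ {y : realSub κY | ‖incl κY y‖ < ε},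
          (reP κX hκX ∘L (fderiv ℂ Qt 0).restrictScalars ℝ ∘L incl κY) (B - (reP κY hκY ∘L
              (hop.mkContinuous b hHop).restrictScalars ℝ ∘L incl κX)
              (({y : realSub κY | ‖incl κY y‖ < ε}).piecewise
                (fun y => reP κX hκX (Dt (incl κY y))) 0 B)) +
            (fun y => reP κX hκX (nonlin Qt (incl κY y))) (B - (reP κY hκY ∘L
              (hop.mkContinuous b hHop).restrictScalars ℝ ∘L incl κX)
              (({y : realSub κY | ‖incl κY y‖ < ε}).piecewise
                (fun y => reP κX hκX (Dt (incl κY y))) 0 B)) = (Ψ.symm B).2 :=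
  exists_realForm_chartData_of_Q hκX hκY hR hQa hQ0 hQM (conj_eqOn_ball_of_eventually hQa hQt0) hLQh hb hHop hhop
    hq hRC Ψ hΨ

/-- **S46's END OVER A HYPOTHESIS-STYLE REAL FORM (S36's shape), GERM FORM** —
`ShellMeasureLinearizedFromQ.realForm_chartData_of_Q'` with `hQt` replaced by the germ `hQt0`. [folklore] -/
theorem realForm_chartData_of_Q'_germ {E F : Type*} [NormedAddCommGroup E] [NormedSpace ℝ E]
    [NormedAddCommGroup F] [NormedSpace ℝ F] [MeasurableSpace E] [BorelSpace E] [FiniteDimensional ℝ E]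
    [MeasurableSpace F] [BorelSpace F] {ιE : E →L[ℝ] 𝒴} {πE : 𝒴 →L[ℝ] E} {ιF : F →L[ℝ] 𝒳} {πF : 𝒳 →L[ℝ] F}
    (hκX : ∀ X, κX (κX X) = X) (hκY : ∀ B, κY (κY B) = B)
    (hR : 0 < R) (hQa : AnalyticOnNhd ℂ Qt (ball 0 R)) (hQ0 : Qt 0 = 0)
    (hQM : ∀ B ∈ ball (0 : 𝒴) R, ‖Qt B‖ ≤ MQ) (hQt0 : ∀ᶠ B in 𝓝 (0 : 𝒴), Qt (κY B) = κX (Qt B))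
    (hLQh : ∀ X, fderiv ℂ Qt 0 (hop X) = X) (hb : 0 ≤ b) (hHop : ∀ X, ‖hop X‖ ≤ b * ‖X‖)
    (hhop : ∀ X, hop (κX X) = κY (hop X)) (hq : 9 * Mq R MQ * b * ε < 1) (hRC : 3 * ε ≤ R)
    {Dt : 𝒴 → 𝒳} (hDball : ∀ B : 𝒴, ‖B‖ < ε → Dt B ∈ closedBall (0 : 𝒳) (4 * Mq R MQ * ε ^ 2))
    (hDfix : ∀ B : 𝒴, ‖B‖ < ε → nonlin Qt (B - hop (Dt B)) = Dt B)
    (hιπE : ∀ B, κY B = B → ιE (πE B) = B) (hιEr : ∀ y, κY (ιE y) = ιE y)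
    (hιπF : ∀ X, κX X = X → ιF (πF X) = X) (hιFr : ∀ x, κX (ιF x) = ιF x) (hπιF : ∀ x, πF (ιF x) = x)
    {Kf : Type*} [NormedAddCommGroup Kf] [NormedSpace ℝ Kf] (Ψ : (Kf × F) ≃L[ℝ] E)
    (hΨ : ∀ y, (Ψ.symm y).2 = (πF ∘L (fderiv ℂ Qt 0).restrictScalars ℝ ∘L ιE) y) :
    Measurable (fun B : E => B - (πE ∘L (hop.mkContinuous b hHop).restrictScalars ℝ ∘L ιF)
        (({y : E | ‖ιE y‖ < ε}).piecewise (fun y => πF (Dt (ιE y))) 0 B)) ∧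
      InjOn (fun B : E => B - (πE ∘L (hop.mkContinuous b hHop).restrictScalars ℝ ∘L ιF)
        (({y : E | ‖ιE y‖ < ε}).piecewise (fun y => πF (Dt (ιE y))) 0 B)) {y : E | ‖ιE y‖ < ε} ∧
      (∀ B ∈ {y : E | ‖ιE y‖ < ε}, HasFDerivWithinAt
        (fun B : E => B - (πE ∘L (hop.mkContinuous b hHop).restrictScalars ℝ ∘L ιF)
          (({y : E | ‖ιE y‖ < ε}).piecewise (fun y => πF (Dt (ιE y))) 0 B))
        (ContinuousLinearMap.id ℝ E - (πE ∘L (hop.mkContinuous b hHop).restrictScalars ℝ ∘L ιF).comp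
          (πF ∘L (fderiv ℂ Dt (ιE B)).restrictScalars ℝ ∘L ιE)) {y : E | ‖ιE y‖ < ε} B) ∧
      ∀ B ∈ {y : E | ‖ιE y‖ < ε},
        (πF ∘L (fderiv ℂ Qt 0).restrictScalars ℝ ∘L ιE) (B - (πE ∘L (hop.mkContinuous b hHop).restrictScalars ℝ ∘L ιF)
            (({y : E | ‖ιE y‖ < ε}).piecewise (fun y => πF (Dt (ιE y))) 0 B)) +
          (fun y => πF (nonlin Qt (ιE y))) (B - (πE ∘L (hop.mkContinuous b hHop).restrictScalars ℝ ∘L ιF)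
            (({y : E | ‖ιE y‖ < ε}).piecewise (fun y => πF (Dt (ιE y))) 0 B)) = (Ψ.symm B).2 :=
  realForm_chartData_of_Q' hκX hκY hR hQa hQ0 hQM (conj_eqOn_ball_of_eventually hQa hQt0) hLQh hb hHop hhop hq hRC
    hDball hDfix hιπE hιEr hιπF hιFr hπιF Ψ hΨ

end Junction

/-! ## §3 The germ by continuity, in row S47's currency -/

section Regime

variable {𝔸 : Type*} [NormedRing 𝔸]

omit [NormedSpace ℂ 𝒴] in
/-- **A STRICT REGIME AT `0` PERSISTS NEAR `0`**: a map continuous at `0` whose value at `0` is within `< r` of `1`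
stays within `≤ r` of `1` on a neighbourhood of `0`. [folklore] -/
theorem eventually_norm_sub_one_le {f : 𝒴 → 𝔸} {r : ℝ} (hf : ContinuousAt f 0) (h0 : ‖f 0 - 1‖ < r) :
    ∀ᶠ B in 𝓝 (0 : 𝒴), ‖f B - 1‖ ≤ r := by
  have hg : ContinuousAt (fun B => ‖f B - 1‖) 0 := (hf.sub continuousAt_const).norm
  exact (hg.tendsto.eventually_lt_const h0).mono fun _ h => h.le

omit [NormedSpace ℂ 𝒴] in
/-- **ROW S47's THREE REGIME HYPOTHESES HOLD EVENTUALLY AT `0`** once they hold STRICTLY at `0` and the maps are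
continuous at `0`: for finitely many maps `W x` (`x ∈ s` — the block sites; at the printed average
`W x B = W_x(V′V)`, equal to `W_x(V)` at `B′ = 0`) and one map `Z` (the quotient `M_c(V′V)M_c(V)⁻¹`, `= 1` at
`B′ = 0`). [folklore] -/
theorem eventually_regime {ι : Type*} (s : Finset ι) {W : ι → 𝒴 → 𝔸} {Z : 𝒴 → 𝔸} {r : ℝ}
    (hWc : ∀ x ∈ s, ContinuousAt (W x) 0) (hW0 : ∀ x ∈ s, ‖W x 0 - 1‖ < r)
    (hZc : ContinuousAt Z 0) (hZ0 : ‖Z 0 - 1‖ < r) :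
    ∀ᶠ B in 𝓝 (0 : 𝒴), (∀ x ∈ s, ‖W x B - 1‖ ≤ r) ∧ ‖Z B - 1‖ ≤ r := by
  refine Filter.Eventually.and ?_ (eventually_norm_sub_one_le hZc hZ0)
  exact (Filter.eventually_all_finset s).2 fun x hx => eventually_norm_sub_one_le (hWc x hx) (hW0 x hx)

omit [NormedSpace ℂ 𝒴] in
/-- the value `1` at `0` is a strict regime for every `r > 0` (the quotient `Z(0) = M_c(V)M_c(V)⁻¹ = 1`).
[folklore] -/
theorem norm_sub_one_lt_of_eq_one {Z : 𝒴 → 𝔸} {r : ℝ} (hZ : Z 0 = 1) (hr : 0 < r) : ‖Z 0 - 1‖ < r := by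
  rwa [hZ, sub_self, norm_zero]

/-- **(Q4) ON THE WHOLE ANALYTICITY BALL FROM AN S47-SHAPED REGIME-CONDITIONAL IDENTITY + CONTINUITY AT `0`.**  If
(Q1) `Qt` is analytic on `ball 0 R`; the ⋆-identity `Qt (κ_𝒴 B) = κ_𝒳 (Qt B)` is known WHENEVER the finitely many
regime quantities `W x B` (`x ∈ s`) and `Z B` are within `≤ r` of `1` (row S47's `star_Qtilde` shape, `r = 1∕3`);
and the `W x`, `Z` are continuous at `0` with `‖W x 0 − 1‖ < r`, `‖Z 0 − 1‖ < r` — then (Q4) holds for EVERY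
`B ∈ ball 0 R`: §3 gives the germ, §1 propagates it.  No regime radius is computed. [folklore] -/
theorem conj_eqOn_ball_of_regime {ι : Type*} (s : Finset ι) {W : ι → 𝒴 → 𝔸} {Z : 𝒴 → 𝔸} {r : ℝ}
    (hQa : AnalyticOnNhd ℂ Qt (ball 0 R))
    (hstar : ∀ B : 𝒴, (∀ x ∈ s, ‖W x B - 1‖ ≤ r) → ‖Z B - 1‖ ≤ r → Qt (κY B) = κX (Qt B))
    (hWc : ∀ x ∈ s, ContinuousAt (W x) 0) (hW0 : ∀ x ∈ s, ‖W x 0 - 1‖ < r)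
    (hZc : ContinuousAt Z 0) (hZ0 : ‖Z 0 - 1‖ < r) :
    ∀ B ∈ ball (0 : 𝒴) R, Qt (κY B) = κX (Qt B) :=
  conj_eqOn_ball_of_eventually hQa
    ((eventually_regime s hWc hW0 hZc hZ0).mono fun B hB => hstar B hB.1 hB.2)

/-- the same with the ⋆-identity written in S47's ORIENTATION `κ_𝒳 (Qt B) = Qt (κ_𝒴 B)` («`(Q̃(B′))⋆ = Q̃(B′⋆)`»).
[folklore] -/
theorem conj_eqOn_ball_of_regime' {ι : Type*} (s : Finset ι) {W : ι → 𝒴 → 𝔸} {Z : 𝒴 → 𝔸} {r : ℝ}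
    (hQa : AnalyticOnNhd ℂ Qt (ball 0 R))
    (hstar : ∀ B : 𝒴, (∀ x ∈ s, ‖W x B - 1‖ ≤ r) → ‖Z B - 1‖ ≤ r → κX (Qt B) = Qt (κY B))
    (hWc : ∀ x ∈ s, ContinuousAt (W x) 0) (hW0 : ∀ x ∈ s, ‖W x 0 - 1‖ < r)
    (hZc : ContinuousAt Z 0) (hZ0 : ‖Z 0 - 1‖ < r) :
    ∀ B ∈ ball (0 : 𝒴) R, Qt (κY B) = κX (Qt B) :=
  conj_eqOn_ball_of_regime s hQa (fun B hW hZ => (hstar B hW hZ).symm) hWc hW0 hZc hZ0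

end Regime

/-! ## §4 Sanity: the germ hypothesis is strictly weaker in form, equal in force (a linear toy) -/

/-- TOY (binder shapes only, says nothing about Bałaban's averages, c3): on `𝒴 = 𝒳 = ℂ` with `Qt = id` and both
conjugations `= star`, the ⋆-identity holds near `0` (indeed everywhere), and §1 returns it on every ball.
[folklore] -/
example (R : ℝ) : ∀ B ∈ ball (0 : ℂ) R,
    (id : ℂ → ℂ) ((starₗᵢ ℂ : ℂ ≃ₗᵢ⋆[ℂ] ℂ) B) = (starₗᵢ ℂ : ℂ ≃ₗᵢ⋆[ℂ] ℂ) ((id : ℂ → ℂ) B) :=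
  conj_eqOn_ball_of_eventually (fun _ _ => analyticAt_id) (Filter.Eventually.of_forall fun _ => rfl)

end Summit.QuantumFields.BalabanUV.T4Continuum.ShellMeasureEquivariantGerm

end
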